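import Mathlib.Geometry.Manifold.PartitionOfUnity
import Mathlib.Geometry.Manifold.LocalDiffeomorph
import Mathlib.MeasureTheory.Measure.Haar.OfBasis
import Mathlib.MeasureTheory.Integral.Bochner.Set
import Mathlib.LinearAlgebra.Orientation
import Mathlib.Data.Real.Sign
import Literature.Geometry.Kaehler.ManifoldForms
import Literature.Geometry.Kaehler.RiemannianHodge
import HarnessLib

-- provenance: harness21/H21/H21/Prelude/TranscendKaehlerL/FormIntegration.lean @ c7dd9de (interim HEAD d8f2665); M5 mechanical rewrite
/-!
# Integration of top-degree forms and Stokes' theorem on closed manifolds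

Trunk: TranscendKaehlerL (`H21/Outlines/TranscendKaehlerL.md`, §C7 FormIntegration); notion
`de_rham_cohomology_manifold` (integration and Stokes half). Builds on the G21 slice
`H21/Prelude/Kaehler/ManifoldForms.lean` (`MForm`, `inChart`, `IsSmoothForm`, `mextDeriv`,
`exactSmoothForms`, `deRhamCohomology`) and `H21/Prelude/Kaehler/RiemannianHodge.lean`
(`riemannianVolumeForm`).

Setting: a real manifold `M` modelled on `I : ModelWithCorners ℝ E H` with `E`
finite-dimensional, `finrank ℝ E = n` (as `[Fact (finrank ℝ E = n)]`), `E` carrying its Borel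
σ-algebra, and a bare pointwise family of orientations
`o : (x : M) → Orientation ℝ (TangentSpace I x) (Fin n)` (G21 design note D7).

## Main definitions

* `Literature.modelBasis E n`: a fixed reference basis of the model space indexed by `Fin n`, with its
  Lebesgue (Haar) measure `(modelBasis E n).addHaar`.
* `Literature.chartSign o x₀ y ∈ {-1, 0, 1}`: the sign of the orientation `o` evaluated on the
  coordinate frame of the extended chart at `x₀`, at the chart point `y : E`.
* `Literature.MForm.integralPU ρ o c α`: `∫_M α` computed with a smooth partition of unity `ρ` whose
  `i`-th function is supported in the chart at `c i`:
  `∑ᶠ i, ∫_{chart target} sign · (ρ i ∘ chart⁻¹) · α(chart frame) d(Lebesgue)`.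
* `Literature.chartPartitionOfUnity I M`: a chosen smooth partition of unity subordinate to the chart
  sources (`SmoothPartitionOfUnity.exists_isSubordinate_chartAt_source`).
* `Literature.MForm.integral o α`: the integral `∫_M α` of a top-degree form over `(M, o)`.
* `Literature.IsContinuousOrientation o`: metric-free local constancy of the orientation family `o`
  (i.e. `(M, o)` is an oriented manifold).
* `Literature.deRhamCohomology.integral o ho : H^n_dR(M) →ₗ[ℝ] ℝ`, `[α] ↦ ∫_M α`, on a *closed*
  manifold (compact, boundaryless), where Stokes gives `∫_M dβ = 0`.

## Main statements (sorried)

* `Literature.Geometry.Kaehler.MForm.integralPU_eq_integral`: independence of the subordinate partition of unity.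
* `Literature.MForm.integral_add/smul/neg_orientation/pullback`.
* `Literature.Geometry.Kaehler.MForm.integral_mextDeriv_eq_zero`: **Stokes' theorem** on a closed manifold, `∫_M dβ = 0`
  (Warner (1983), Thm. 4.9 with `∂M = ∅`), and `integral_eq_zero_of_mem_exactSmoothForms`.
* Bridge lemmas with G21's orientation hypothesis `IsSmoothForm (riemannianVolumeForm o)`:
  `isContinuousOrientation_of_isSmoothForm_riemannianVolumeForm` and its converse.
* `Literature.NumberTheory.Transcendental.integral_riemannianVolumeForm_pos`, `Literature.NumberTheory.Transcendental.integral_smul_riemannianVolumeForm_nonneg`.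
* `Literature.Geometry.Kaehler.deRhamCohomology.integral_bijective`: `H^n_dR(M) ≅ ℝ` for `M` closed, connected.

## Mathlib status

Mathlib (pinned v4.32.0) has smooth partitions of unity subordinate to chart sources
(`SmoothPartitionOfUnity.exists_isSubordinate_chartAt_source`), the Haar/Lebesgue measure of a
basis (`Module.Basis.addHaar`), the Bochner integral, orientations of modules
(`Orientation`, `Orientation.map`, `Module.Ray.someVector`), `Real.sign`, diffeomorphisms and
their differentials as equivalences (`Diffeomorph.mfderivToContinuousLinearEquiv`). It has no
integration of differential forms over manifolds and no Stokes theorem (searched `integral` in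
`Geometry/Manifold`, `Stokes`, `volume form` on manifolds: only `Orientation.volumeForm` on inner
product spaces and the box-integral divergence theorem). Everything below the reference basis is
new glue.

## Design notes

* Integration is **metric-free**: only the orientation family `o` enters, through the sign
  `chartSign o x₀ y` of `(o _).someVector` on the chart frame; the value of `someVector` on a
  frame has a well-defined sign (positive multiples), so `chartSign` and hence the integral flip
  sign under `o ↦ -o` *unconditionally*.
* The reference basis `modelBasis E n` is fixed once and for all (`Module.finBasis`, reindexed);
  the integrand `α.inChart x₀ y (modelBasis E n)` times `(modelBasis E n).addHaar` is
  basis-independent up to the sign absorbed by `chartSign` (change of variables), which is part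
  of the content of `integralPU_eq_integral`.
* `chartPartitionOfUnity I M : SmoothPartitionOfUnity M I M univ` is indexed by the points of
  `M` (Mathlib's `exists_isSubordinate_chartAt_source`), so the chart-centre map is the identity.
* Junk values: for non-compactly-supported or non-measurable integrands the Bochner integral and
  `finsum` return `0`; the theorems therefore assume `[CompactSpace M]`, smoothness of the form
  and `IsContinuousOrientation o` where needed. `integral_smul`, `integral_neg_orientation` and
  `integral_smul_riemannianVolumeForm_nonneg` hold unconditionally.
* `deRhamCohomology.integral` is defined by `Submodule.liftQ` in a section with
  `[CompactSpace M] [I.Boundaryless]` (**mandatory**: the `liftQ` obligation `∫ (exact) = 0` is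
  Stokes and is false with boundary, `∫_{[0,1]} dx = 1`).
* `MForm.integral_pullback` spells the pull-back `f^*β` inline as
  `fun x ↦ (β (f x)).compContinuousLinearMap (mfderiv I I' f x)`; this is definitionally
  `MForm.pullback f β` of the sibling file `FormsAlgebra.lean` (C6), which this file does not
  import.
* `[IsManifold I ∞ M]` is assumed from `chartPartitionOfUnity` on (Mathlib's existence theorem
  needs it); the bare `chartSign`, `integralPU`, `IsContinuousOrientation` elaborate on any
  charted space.

## References

* F. W. Warner, *Foundations of Differentiable Manifolds and Lie Groups* (1983), §§4.8–4.10
  (integration, Stokes' theorem 4.9, volume form 4.10), §6.1.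
* J. M. Lee, *Introduction to Smooth Manifolds* (2nd ed., 2013), Ch. 15–17 (orientations,
  integration, Stokes, top de Rham cohomology Thm. 17.30–17.31).
-/

noncomputable section

open scoped Manifold ContDiff Topology
open Bundle Set Module MeasureTheory

namespace Literature.NumberTheory.Transcendental

variable {E : Type*} [NormedAddCommGroup E] [NormedSpace ℝ E] [FiniteDimensional ℝ E]
  {n : ℕ} [Fact (finrank ℝ E = n)]
  {H : Type*} [TopologicalSpace H] {I : ModelWithCorners ℝ E H}
  {M : Type*} [TopologicalSpace M] [ChartedSpace H M]

/-! ### Chart-level data: reference basis, orientation sign, chart integrals -/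

section ChartLevel

variable (E n) in
/-- A fixed reference basis of the model space `E`, indexed by `Fin n` (`finrank ℝ E = n`):
Mathlib's `Module.finBasis`, reindexed along `finCongr`. Its Haar measure
`(modelBasis E n).addHaar` is the Lebesgue measure giving mass `1` to the parallelepiped it
spans. Lee (2013), Ch. 16 (integration on `ℝⁿ`). [cite: Lee2013] -/
def modelBasis : Basis (Fin n) ℝ E :=
  (finBasis ℝ E).reindex (finCongr Fact.out)

/-- The **orientation sign** of the extended chart at `x₀`, at the chart point `y : E`, with
respect to the orientation family `o`: the sign (`-1`, `0` or `1`) of a representative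
`(o x).someVector` of the orientation at `x = (extChartAt I x₀).symm y`, evaluated on the chart
frame `j ↦ D((extChartAt I x₀).symm)(y) · (modelBasis E n j)`. It is `1` (resp. `-1`) iff the
chart is positively (resp. negatively) oriented at `y` for `o`; the value `0` occurs only off
`(extChartAt I x₀).target` (junk). Lee (2013), Ch. 15 (oriented charts); Warner (1983), §4.1. [cite: Lee2013] -/
def chartSign (o : (x : M) → Orientation ℝ (TangentSpace I x) (Fin n)) (x₀ : M) (y : E) : ℝ :=
  Real.sign ((o ((extChartAt I x₀).symm y)).someVector fun j ↦
    mfderivWithin 𝓘(ℝ, E) I (extChartAt I x₀).symm (range I) y (modelBasis E n j))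

/-- **Continuity (local constancy) of an orientation family**, metric-free form: for every
`x₀`, the orientation sign of the chart at `x₀` is constant and nonzero for chart points
`y ∈ range I` near the centre `extChartAt I x₀ x₀`. This says exactly that `(M, o)` is an
oriented manifold in the usual sense (Lee (2013), Prop. 15.6: a pointwise orientation is
continuous iff every point has a positively oriented chart). See
`isContinuousOrientation_of_isSmoothForm_riemannianVolumeForm` for the bridge to G21's
metric hypothesis `IsSmoothForm (riemannianVolumeForm o)`. [cite: Lee2013] -/
def IsContinuousOrientation (o : (x : M) → Orientation ℝ (TangentSpace I x) (Fin n)) : Prop :=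
  ∀ x₀ : M, ∀ᶠ y in 𝓝[range I] (extChartAt I x₀ x₀),
    chartSign o x₀ y = chartSign o x₀ (extChartAt I x₀ x₀) ∧ chartSign o x₀ y ≠ 0

/-- Reversing the orientation family reverses every chart sign (unconditionally: the two
representatives `(-r).someVector` and `-(r.someVector)` of the ray `-r` are positive multiples
of each other). Lee (2013), Ch. 15. [cite: Lee2013] -/
theorem chartSign_neg (o : (x : M) → Orientation ℝ (TangentSpace I x) (Fin n)) (x₀ : M)
    (y : E) : chartSign (fun x ↦ -o x) x₀ y = -chartSign o x₀ y := by
  suffices h : ∀ (r : Orientation ℝ (TangentSpace I ((extChartAt I x₀).symm y)) (Fin n)) v,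
      Real.sign ((-r).someVector v) = -Real.sign (r.someVector v) from h _ _
  intro r v
  have h0 : ∀ r : Orientation ℝ (TangentSpace I ((extChartAt I x₀).symm y)) (Fin n),
      r.someVector ≠ 0 := fun r ↦ Module.Ray.someVector_ne_zero r
  have hray : SameRay ℝ (-r).someVector (-r.someVector) := by
    rw [← ray_eq_iff (R := ℝ) (h0 _) (neg_ne_zero.2 (h0 r)), Module.Ray.someVector_ray,
      ← neg_rayOfNeZero (R := ℝ) _ (h0 r), Module.Ray.someVector_ray]
  obtain ⟨c, hc, hcv⟩ := hray.exists_pos_right (h0 _) (neg_ne_zero.2 (h0 r))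
  rw [hcv, AlternatingMap.smul_apply, AlternatingMap.neg_apply, smul_eq_mul, ← Real.sign_neg]
  generalize -(r.someVector v) = t
  rcases lt_trichotomy t 0 with ht | rfl | ht
  · rw [Real.sign_of_neg ht, Real.sign_of_neg (mul_neg_of_pos_of_neg hc ht)]
  · simp [Real.sign_zero]
  · rw [Real.sign_of_pos ht, Real.sign_of_pos (mul_pos hc ht)]

section PartitionOfUnity

variable [T2Space M] [SigmaCompactSpace M] [IsManifold I ∞ M]

variable (I M) in
/-- A chosen smooth partition of unity on `M`, indexed by the points of `M` and subordinate to
the chart sources `x ↦ (chartAt H x).source` (Mathlib's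
`SmoothPartitionOfUnity.exists_isSubordinate_chartAt_source`). Warner (1983), Thm. 1.11 /
Def. 4.8. [cite: Warner1983] -/
def chartPartitionOfUnity : SmoothPartitionOfUnity M I M univ :=
  Classical.choose (SmoothPartitionOfUnity.exists_isSubordinate_chartAt_source I M)

/-- The chosen partition of unity is subordinate to the chart sources. [folklore] -/
theorem chartPartitionOfUnity_isSubordinate :
    (chartPartitionOfUnity I M).IsSubordinate fun x ↦ (chartAt H x).source :=
  Classical.choose_spec (SmoothPartitionOfUnity.exists_isSubordinate_chartAt_source I M)

end PartitionOfUnity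

variable [MeasurableSpace E] [BorelSpace E]

/-- The integral of a top-degree form `α` over `(M, o)` computed with a smooth partition of
unity `ρ` and chart centres `c : ι → M` (meaningful when `ρ i` is supported in the source of
the chart at `c i`):
`∑ᶠ i, ∫_{(extChartAt I (c i)).target} chartSign · (ρ i ∘ chart⁻¹) · (chart_* α)(e₁, …, eₙ) dλ`,
where `e = modelBasis E n` and `λ = e.addHaar`. Warner (1983), Def. 4.8; Lee (2013),
Ch. 16 (integration on manifolds, eq. (16.1)–(16.2)). [cite: Warner1983] -/
def _root_.Literature.Geometry.Kaehler.MForm.integralPU {ι : Type*} {s : Set M} (ρ : SmoothPartitionOfUnity ι I M s)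
    (o : (x : M) → Orientation ℝ (TangentSpace I x) (Fin n)) (c : ι → M) (α : Literature.Geometry.Kaehler.MForm I M ℝ n) :
    ℝ :=
  ∑ᶠ i, ∫ y in (extChartAt I (c i)).target,
    chartSign o (c i) y * ρ i ((extChartAt I (c i)).symm y) *
      α.inChart (c i) y (modelBasis E n) ∂(modelBasis E n).addHaar

end ChartLevel

/-! ### The integral of a top-degree form -/

section Integral

variable [MeasurableSpace E] [BorelSpace E] [T2Space M] [SigmaCompactSpace M] [IsManifold I ∞ M]

/-- The **integral** `∫_M α` of a top-degree form `α` over the manifold `M` with orientation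
family `o`, defined via the chosen partition of unity `chartPartitionOfUnity I M` subordinate
to the chart sources. Independent of that choice (`MForm.integralPU_eq_integral`).
Warner (1983), Def. 4.8; Lee (2013), Prop. 16.5. [cite: Warner1983] -/
def _root_.Literature.Geometry.Kaehler.MForm.integral (o : (x : M) → Orientation ℝ (TangentSpace I x) (Fin n)) (α : Literature.Geometry.Kaehler.MForm I M ℝ n) :
    ℝ :=
  α.integralPU (chartPartitionOfUnity I M) o id

variable (o : (x : M) → Orientation ℝ (TangentSpace I x) (Fin n))

section MForm
open Literature.Geometry.Kaehler (MForm)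
open Literature.Geometry.Kaehler.MForm

/-- **Independence of the partition of unity.** On a compact oriented manifold, the integral of
a smooth top form computed with *any* smooth partition of unity `ρ` subordinate to the sources
of the charts centred at `c i` equals `∫_M α`. Warner (1983), 4.8 (well-definedness);
Lee (2013), Prop. 16.5. [cite: Warner1983] -/
def _root_.Literature.Geometry.Kaehler.MForm.integralPU_eq_integral : Prop :=
  ∀ [CompactSpace M] {ι : Type*} (ρ : SmoothPartitionOfUnity ι I M univ) (c : ι → M),
    (ρ.IsSubordinate fun i ↦ (chartAt H (c i)).source) → IsContinuousOrientation o →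
      ∀ {α : MForm I M ℝ n}, Literature.Geometry.Kaehler.IsSmoothForm α → α.integralPU ρ o c = α.integral o

/-- Additivity of the integral on smooth top forms of a compact oriented manifold,
`∫_M (α + β) = ∫_M α + ∫_M β` (Warner (1983), 4.8(a); Lee (2013), Prop. 16.6(a)). [cite: Warner1983] -/
def _root_.Literature.Geometry.Kaehler.MForm.integral_add : Prop :=
  ∀ [CompactSpace M], IsContinuousOrientation o → ∀ {α β : MForm I M ℝ n},
    Literature.Geometry.Kaehler.IsSmoothForm α → Literature.Geometry.Kaehler.IsSmoothForm β → (α + β).integral o = α.integral o + β.integral o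

/-- Homogeneity of the integral, `∫_M c • α = c * ∫_M α`; this holds unconditionally (both the
Bochner integral and `finsum` commute with scalars without integrability or finiteness
hypotheses). Warner (1983), 4.8(a); Lee (2013), Prop. 16.6(a). [cite: Warner1983] -/
theorem _root_.Literature.Geometry.Kaehler.MForm.integral_smul (c : ℝ) (α : MForm I M ℝ n) : (c • α).integral o = c * α.integral o := by
  simp only [MForm.integral, MForm.integralPU, MForm.inChart_smul, Pi.smul_apply,
    ContinuousAlternatingMap.smul_apply, smul_eq_mul, mul_finsum, ← integral_const_mul]
  congr 1 with i
  congr 1 with y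
  ring

/-- **Orientation reversal**: `∫_{(M, -o)} α = -∫_{(M, o)} α`, unconditionally
(`chartSign_neg`). Warner (1983), 4.8(b); Lee (2013), Prop. 16.6(b). [cite: Warner1983] -/
theorem _root_.Literature.Geometry.Kaehler.MForm.integral_neg_orientation (α : MForm I M ℝ n) :
    α.integral (fun x ↦ -o x) = -α.integral o := by
  simp only [MForm.integral, MForm.integralPU, chartSign_neg, neg_mul, integral_neg,
    finsum_neg_distrib]

/-- **Diffeomorphism invariance**: if `f : M → N` is an orientation-preserving diffeomorphism
of compact oriented `n`-manifolds and `β` a smooth top form on `N`, then `∫_M f^*β = ∫_N β`.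
The pull-back `f^*β` is spelled inline, `x ↦ β (f x) ∘ (mfderiv I I' f x)` (definitionally the
`MForm.pullback` of `FormsAlgebra.lean`); orientation preservation is
`Orientation.map (df_x) (o x) = o' (f x)` for all `x`, with `df_x` the differential as a linear
equivalence (`Diffeomorph.mfderivToContinuousLinearEquiv`).
Warner (1983), 4.8(c); Lee (2013), Prop. 16.6(d). [cite: Warner1983] -/
def _root_.Literature.Geometry.Kaehler.MForm.integral_pullback : Prop :=
  ∀ {E' : Type*} [NormedAddCommGroup E'] [NormedSpace ℝ E'] [FiniteDimensional ℝ E'] [Fact (finrank ℝ E' = n)] [MeasurableSpace E'] [BorelSpace E'] {H' : Type*} [TopologicalSpace H'] {I' : ModelWithCorners ℝ E' H'} {N : Type*} [TopologicalSpace N] [ChartedSpace H' N] [T2Space N] [CompactSpace N] [IsManifold I' ∞ N] (o' : (x : N) → Orientation ℝ (TangentSpace I' x) (Fin n)), IsContinuousOrientation o' → ∀ (f : M ≃ₘ^(∞ : WithTop ℕ∞)⟮I, I'⟯ N), (∀ x, Orientation.map (Fin n) (f.mfderivToContinuousLinearEquiv (by simp) x).toLinearEquiv (o x) = o' (f x))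 → ∀ {β : MForm I' N ℝ n}, Literature.Geometry.Kaehler.IsSmoothForm β →
    MForm.integral o (fun x ↦ (β (f x)).compContinuousLinearMap (mfderiv I I' f x)) =
      β.integral o'

/-- **Stokes' theorem on a closed manifold**: on a compact oriented manifold without boundary,
`∫_M dβ = 0` for every smooth `(n-1)`-form `β` (degrees via `h : m + 1 = n`).
Warner (1983), Thm. 4.9 (with `∂M = ∅`); Lee (2013), Thm. 16.11 / Cor. 16.13. The version with
boundary is deferred to the boundary-manifold trunk. [cite: Warner1983] -/
def _root_.Literature.Geometry.Kaehler.MForm.integral_mextDeriv_eq_zero : Prop :=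
  ∀ [CompactSpace M] [I.Boundaryless] {m : ℕ} (h : m + 1 = n), IsContinuousOrientation o →
    ∀ {β : MForm I M ℝ m}, Literature.Geometry.Kaehler.IsSmoothForm β → MForm.integral o (h ▸ Literature.Geometry.Kaehler.mextDeriv β) = 0

/-- Consumer form of Stokes on a closed manifold: exact smooth top forms integrate to zero,
`α ∈ B^n(M) → ∫_M α = 0` (Warner (1983), Thm. 4.9; Lee (2013), Cor. 16.13). False with
boundary (`∫_{[0,1]} dx = 1`), whence `[CompactSpace M] [I.Boundaryless]`. [cite: Warner1983] -/
def _root_.Literature.Geometry.Kaehler.MForm.integral_eq_zero_of_mem_exactSmoothForms : Prop :=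
  ∀ [CompactSpace M] [I.Boundaryless], IsContinuousOrientation o →
    ∀ {α : MForm I M ℝ n}, α ∈ Literature.Geometry.Kaehler.exactSmoothForms I M ℝ n → α.integral o = 0

end MForm

/-! ### Bridge to the Riemannian orientation hypothesis of G21 -/

section Bridge

variable [RiemannianBundle (fun x : M ↦ TangentSpace I x)]

/-- **Bridge lemma** (metric ⇒ metric-free). Under a continuous Riemannian metric, if the
Riemannian volume form of the orientation family `o` is smooth (G21's hypothesis
`IsSmoothForm (riemannianVolumeForm o)`, `H21/Prelude/Kaehler/RiemannianHodge.lean`), then `o` is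
a continuous orientation: `vol_o` is a nowhere-vanishing continuous top form positive on
`o`-oriented frames, so chart signs are locally constant. Lee (2013), Prop. 15.5;
Warner (1983), 4.10. [cite: Lee2013] -/
def isContinuousOrientation_of_isSmoothForm_riemannianVolumeForm : Prop :=
  ∀ [IsContinuousRiemannianBundle E (fun x : M ↦ TangentSpace I x)],
    Literature.Geometry.Kaehler.IsSmoothForm (Literature.Geometry.Kaehler.riemannianVolumeForm o) → IsContinuousOrientation o

/-- **Bridge lemma** (metric-free ⇒ metric). Under a smooth Riemannian metric, the Riemannian
volume form of a continuous orientation family is smooth. Lee (2013), Prop. 15.29;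
Warner (1983), 4.10. [cite: Lee2013] -/
def isSmoothForm_riemannianVolumeForm_of_isContinuousOrientation : Prop :=
  ∀ [IsContinuousRiemannianBundle E (fun x : M ↦ TangentSpace I x)]
    [IsContMDiffRiemannianBundle I ∞ E (fun x : M ↦ TangentSpace I x)],
    IsContinuousOrientation o → Literature.Geometry.Kaehler.IsSmoothForm (Literature.Geometry.Kaehler.riemannianVolumeForm o)

/-- The **volume is positive**: on a nonempty compact oriented Riemannian manifold (continuous
metric, G21's orientation hypothesis), `0 < ∫_M vol_o`. Lee (2013), Prop. 16.6(c) /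
Prop. 15.29; Warner (1983), 4.10. [cite: Lee2013] -/
def integral_riemannianVolumeForm_pos : Prop :=
  ∀ [CompactSpace M] [Nonempty M] [IsContinuousRiemannianBundle E (fun x : M ↦ TangentSpace I x)],
    Literature.Geometry.Kaehler.IsSmoothForm (Literature.Geometry.Kaehler.riemannianVolumeForm o) → 0 < (Literature.Geometry.Kaehler.riemannianVolumeForm o).integral o

/-- For a pointwise nonnegative function `f`, `0 ≤ ∫_M f • vol_o`. This holds unconditionally:
each chart integrand `chartSign o · ρ · vol_o(chart frame)` is pointwise `≥ 0`, because
`vol_o` lies in the ray `o` (`Orientation.volumeForm`) and so has the sign `chartSign o` on the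
chart frame, and the Bochner integral and `finsum` of nonnegative functions are `≥ 0` even at
junk values. Lee (2013), Prop. 16.6(c). [cite: Lee2013] -/
def integral_smul_riemannianVolumeForm_nonneg : Prop :=
  ∀ {f : M → ℝ}, (∀ x, 0 ≤ f x) → 0 ≤ Literature.Geometry.Kaehler.MForm.integral o (fun x ↦ f x • Literature.Geometry.Kaehler.riemannianVolumeForm o x)

end Bridge

/-! ### Integration on top de Rham cohomology of a closed manifold -/

section Closed

variable [CompactSpace M] [I.Boundaryless]

/-- **Integration on top-degree de Rham cohomology** of a closed oriented `n`-manifold,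
`H^n_dR(M) →ₗ[ℝ] ℝ`, `[α] ↦ ∫_M α`, obtained by `Submodule.liftQ` from the integral on closed
smooth `n`-forms. Relies on: `MForm.integral_smul` (proved) and the named facts
`MForm.integral_add` (hypothesis `hadd`) and `MForm.integral_eq_zero_of_mem_exactSmoothForms`
(Stokes, hypothesis `hex`; this is why the definition lives under
`[CompactSpace M] [I.Boundaryless]` — with boundary the map does not descend,
`∫_{[0,1]} dx = 1`). Warner (1983), 4.9 / 5.36 ff.; Lee (2013), Thm. 17.30–17.31. [cite: Warner1983] -/
def _root_.Literature.Geometry.Kaehler.deRhamCohomology.integral (ho : IsContinuousOrientation o) (hadd : Literature.Geometry.Kaehler.MForm.integral_add o)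
    (hex : Literature.Geometry.Kaehler.MForm.integral_eq_zero_of_mem_exactSmoothForms o) :
    Literature.Geometry.Kaehler.deRhamCohomology I M ℝ n →ₗ[ℝ] ℝ :=
  Submodule.liftQ _
    { toFun := fun α ↦ Literature.Geometry.Kaehler.MForm.integral o (α : Literature.Geometry.Kaehler.MForm I M ℝ n)
      map_add' := fun α β ↦ hadd ho α.2.1 β.2.1
      map_smul' := fun c α ↦ Literature.Geometry.Kaehler.MForm.integral_smul o c (α : Literature.Geometry.Kaehler.MForm I M ℝ n) }
    fun α hα ↦ by
      simpa using hex ho (Submodule.mem_comap.1 hα)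

/-- The cohomological integral of a class `[α]` is `∫_M α` (by construction). [folklore] -/
@[simp]
theorem _root_.Literature.Geometry.Kaehler.deRhamCohomology.integral_mk (ho : IsContinuousOrientation o)
    (hadd : Literature.Geometry.Kaehler.MForm.integral_add o) (hex : Literature.Geometry.Kaehler.MForm.integral_eq_zero_of_mem_exactSmoothForms o)
    (α : Literature.Geometry.Kaehler.closedSmoothForms I M ℝ n) :
    Literature.Geometry.Kaehler.deRhamCohomology.integral o ho hadd hex (Literature.Geometry.Kaehler.deRhamCohomology.mk α) =
      Literature.Geometry.Kaehler.MForm.integral o (α : Literature.Geometry.Kaehler.MForm I M ℝ n) :=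
  rfl

/-- **Top de Rham cohomology of a closed connected oriented manifold**: integration
`H^n_dR(M) → ℝ` is a linear bijection (surjective by `∫ vol > 0` for a bump top form,
injective since a top form with `∫_M α = 0` is exact). False with boundary
(`H¹_dR([0,1]) = 0`). Lee (2013), Thm. 17.30–17.31; Warner (1983), 4.9 & Ex. 4.18;
Bott–Tu (1982), Cor. I.5.8. [cite: Lee2013] -/
def _root_.Literature.Geometry.Kaehler.deRhamCohomology.integral_bijective : Prop :=
  ∀ [ConnectedSpace M] [Nonempty M] (ho : IsContinuousOrientation o) (hadd : Literature.Geometry.Kaehler.MForm.integral_add o)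
    (hex : Literature.Geometry.Kaehler.MForm.integral_eq_zero_of_mem_exactSmoothForms o),
    Function.Bijective (Literature.Geometry.Kaehler.deRhamCohomology.integral o ho hadd hex)

end Closed

end Integral

end Literature.NumberTheory.Transcendental
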